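import Summits.QuantumFields.YangMills.Theorems.FlatTubeReductionTubeFormNearFar
import Summits.QuantumFields.YangMills.Theorems.FlatTubeReductionProfileNormalisation
import HarnessLib

/-!
# (B-T) AT RATE for the NORMALISED profile `Ω_u = n(u)·Ω₀`: the kernel estimate it needs is about the FROZEN profile with the dressing `V = W/n`
# (route `FlatTubeReduction`, crux K1 `NearFlatRatioLaw` stmt-QuantumFields-24720; seat `ym-line-ftr-p1` g14; rate twin «ratepack-v3 / frozen fibres»; R2b1 RECORD rung — no summit
# statement is proved here)

WHY (memo `Cruxes/NearFlatRatioLaw/Lines/ratepack-v3-frozen-g12.md` §8.2).  `AnalyticRatePotInput.hT` is stated for `boFunAd φ Ω_β` with the (u-dependent) normalised profile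
`Ω_β(u,·) = n_β(u)Ω₀_β` of `…NormalisedProfile` and the dressing `W_β` of `…ProfileDressingPackage`; by `boFunAd_scale` the BO function is the FROZEN one with amplitude `φ·n`, so
`tubeForm_boFun_near_of_nearFar` applies with amplitude `φn` and any dressing `V` with `n·V = W` on the window.  Hence the ONLY kernel input of hT at rate is the frozen-profile comparison
`|𝒦_β^{Ω₀}(u,u') − c·V(u)V(u')·K̃₁(u,u')| ≤ κc|V(u)||V(u')|K̃₁(u,u') + θ` on the window (`V = W/n`, `V² = 2f̂` up to `O(λ_b²)` there).
  ★★★ `tubeForm_boFunAd_normalised_near_of_nearFar`.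
HONEST FRAMING: wiring; the near (rate, symmetric dressing) and far (absolute) kernel estimates for the frozen profile remain the open analytic content of hT; femto rung R2b1 (RECORD label);
not infinite volume, not a gap, not Clay.  No defs, no named facts, no `sorry`.
-/

set_option autoImplicit false

noncomputable section

open MeasureTheory Filter Topology Real
open scoped BigOperators
open Literature.MathematicalPhysics.QuantumFieldTheory
open Literature.MathematicalPhysics.QuantumLattice

namespace Summit.QuantumFields.YangMills.Theorems.FemtoTransferGap.RateTube

open Summit.QuantumFields.YangMills.Theorems.FemtoTransferGap
open Summit.QuantumFields.YangMills.Theorems.FemtoTransferGap.TwoLattice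
open Summit.QuantumFields.YangMills.Theorems.FemtoTransferGap.TwoLattice.ConstTube
open Summit.QuantumFields.YangMills.Theorems.FemtoTransferGap.TwoLattice.Avg
open Summit.QuantumFields.YangMills.Theorems.FemtoTransferGap.TwoLattice.Stiff (LinkSpace)

variable {L : ℕ} [NeZero L]

/-- A BO function with a frozen profile written through `boFunAd`. [folklore] -/
theorem boFunAd_frozen (ψ : GaugeConfig 3 1 SU2 → ℝ) (Ω₀ : LinkSpace L → ℝ) : boFunAd L ψ (fun _ x => Ω₀ x) = boFun L ψ Ω₀ := rfl

set_option maxHeartbeats 800000 in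
/-- ★★★ **(B-T) AT RATE FOR THE NORMALISED PROFILE.**  Frozen `Ω₀` (bounded measurable), slow scalar `n` (measurable, gauge invariant, `|n| ≤ 1`), dressings `W, V` (bounded measurable
gauge invariant) with `n·V = W` on `{orbitDist < δ}` (`δ < 2`), `B ≥ 0`, `c, κ, θ ≥ 0`, and the frozen-profile kernel comparison
`|𝒦_β^{Ω₀}(u,u') − c·V(u)V(u')K̃₁^{(B)}(u,u')| ≤ κ·c·|V(u)||V(u')|·K̃₁^{(B)}(u,u') + θ` on the window.  Then for every gauge-invariant bounded measurable `φ` supported in the window: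
`|T(boFunAd φ (n•Ω₀)) − c·⟨φW, K_B φW⟩| ≤ κc(⟨φW, K_B φW⟩ + λ₀(1,B)‖φW‖²) + θ‖φ‖²`. [cite: Luscher1983, §3] -/
theorem tubeForm_boFunAd_normalised_near_of_nearFar (β : ℝ) {B : ℝ} (hB : 0 ≤ B) {Ω₀ : LinkSpace L → ℝ} (hΩ : Measurable Ω₀) {CΩ : ℝ} (hCΩ : ∀ x, |Ω₀ x| ≤ CΩ)
    {c κ θ δ : ℝ} (hc : 0 ≤ c) (hκ : 0 ≤ κ) (hθ : 0 ≤ θ) (hδ : δ < 2)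
    {n : GaugeConfig 3 1 SU2 → ℝ} (hnm : Measurable n) (hn1 : ∀ u, |n u| ≤ 1) (hng : ∀ (g : Site 3 1 → SU2) (u : GaugeConfig 3 1 SU2), n (gaugeTransform g u) = n u)
    {W V : GaugeConfig 3 1 SU2 → ℝ} (hVm : Measurable V) {CV : ℝ} (hCV : ∀ u, |V u| ≤ CV) (hVg : ∀ (g : Site 3 1 → SU2) (u : GaugeConfig 3 1 SU2), V (gaugeTransform g u) = V u)
    (hnV : ∀ u, orbitDist u < δ → n u * V u = W u)
    (hpt : ∀ u u' : GaugeConfig 3 1 SU2, orbitDist u < δ → orbitDist u' < δ →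
      |boKernel L β Ω₀ u u' - c * (V u * V u') * avgKernel B u u'| ≤ κ * c * (|V u| * |V u'|) * avgKernel B u u' + θ)
    {φ : GaugeConfig 3 1 SU2 → ℝ} (hφm : Measurable φ) {Cφ : ℝ} (hCφ : ∀ u, |φ u| ≤ Cφ)
    (hφg : ∀ (g : Site 3 1 → SU2) (u : GaugeConfig 3 1 SU2), φ (gaugeTransform g u) = φ u) (hsupp : ∀ u, φ u ≠ 0 → orbitDist u < δ) :
    |tubeForm β (boFunAd L φ (fun u x => n u * Ω₀ x)) - c * qform su2Rep B (fun u => φ u * W u) (fun u => φ u * W u)| ≤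
      κ * c * (qform su2Rep B (fun u => φ u * W u) (fun u => φ u * W u) + levelValue su2Rep 1 B 0 * l2 (fun u => φ u * W u) (fun u => φ u * W u)) + θ * l2 φ φ := by
  have hCφ0 : 0 ≤ Cφ := (abs_nonneg _).trans (hCφ 1)
  -- the BO function is the frozen one with amplitude `φ·n`
  have hbo : boFunAd L φ (fun u x => n u * Ω₀ x) = boFun L (fun u => φ u * n u) Ω₀ := by
    rw [show (fun (u : GaugeConfig 3 1 SU2) (x : LinkSpace L) => n u * Ω₀ x) = fun u x => n u * (fun (_ : GaugeConfig 3 1 SU2) (x : LinkSpace L) => Ω₀ x) u x from rfl,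
      boFunAd_scale, boFunAd_frozen]
  -- the amplitude `ψ = φn`: measurable, bounded, gauge invariant, supported in the window; `ψV = φW`
  have hψm : Measurable fun u => φ u * n u := hφm.mul hnm
  have hψC : ∀ u, |φ u * n u| ≤ Cφ := fun u => by
    rw [abs_mul]
    calc |φ u| * |n u| ≤ Cφ * 1 := mul_le_mul (hCφ u) (hn1 u) (abs_nonneg _) hCφ0
      _ = Cφ := mul_one _
  have hψg : ∀ (g : Site 3 1 → SU2) (u : GaugeConfig 3 1 SU2), φ (gaugeTransform g u) * n (gaugeTransform g u) = φ u * n u := fun g u => by rw [hφg, hng]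
  have hψs : ∀ u, φ u * n u ≠ 0 → orbitDist u < δ := fun u h => hsupp u (left_ne_zero_of_mul h)
  have hψV : (fun u => φ u * n u * V u) = fun u => φ u * W u := by
    funext u
    by_cases hu : φ u = 0
    · rw [hu, zero_mul, zero_mul, zero_mul]
    · rw [mul_assoc, hnV u (hsupp u hu)]
  have h := tubeForm_boFun_near_of_nearFar (L := L) β hB hΩ hCΩ hc hκ hθ hδ hVm hCV hVg hpt hψm hψC hψg hψs
  rw [hψV] at h
  -- `‖φn‖² ≤ ‖φ‖²`
  have hl2 : l2 (fun u => φ u * n u) (fun u => φ u * n u) ≤ l2 φ φ := by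
    unfold l2
    refine integral_mono ?_ ?_ fun u => ?_
    · exact integrable_of_measurable_abs_le _ (hψm.mul hψm) (C := Cφ * Cφ) fun u => by rw [abs_mul]; exact mul_le_mul (hψC u) (hψC u) (abs_nonneg _) hCφ0
    · exact integrable_of_measurable_abs_le _ (hφm.mul hφm) (C := Cφ * Cφ) fun u => by rw [abs_mul]; exact mul_le_mul (hCφ u) (hCφ u) (abs_nonneg _) hCφ0
    · show φ u * n u * (φ u * n u) ≤ φ u * φ u
      have hn2 : n u * n u ≤ 1 := by
        have h1 := hn1 u
        have : |n u| * |n u| ≤ 1 * 1 := mul_le_mul h1 h1 (abs_nonneg _) zero_le_one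
        rw [abs_mul_abs_self, one_mul] at this; exact this
      nlinarith [mul_self_nonneg (φ u), hn2]
  rw [hbo]
  exact h.trans (by nlinarith [mul_le_mul_of_nonneg_left hl2 hθ])

end Summit.QuantumFields.YangMills.Theorems.FemtoTransferGap.RateTube

end
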